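import Mathlib
import Literature.NumberTheory.LFunctions.WeilOddGroundState
import Literature.NumberTheory.LFunctions.WeilOddThetaVector
import Literature.NumberTheory.LFunctions.DeBruijnPhiDecreasing
import Summits.RiemannHypothesis.RiemannHypothesis.Theses.OddSector
import Summits.RiemannHypothesis.RiemannHypothesis.Theorems.OddSectorOddOneSignedWindowsExistence

/-!
# Sketch — crux-ideate stmt-RiemannHypothesis-17778 (`OddSector.OddOneSignedWindows`), ideator 1, round 1

First lemmas of the two idea cards, stated over existing declarations
(`Literature.NumberTheory.LFunctions.IsWeilOddGroundState`, `weilThetaPhiDeriv`, the route decl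
`Summit.RiemannHypothesis.RiemannHypothesis.Theses.OddSector.OddOneSignedWindows`).

* Card `resonance-transport-diophantine`: `IsNonresonantWindow`, `DiophantineSelection` (A1, provable now),
  `OriginDifferentiable` (A2, RH-free regularity, hard), `NonresonantIntervalPositivity` (the robust
  RH-strength core) and the kernel-checked composition `oddOneSignedWindows_of_intervals`.
* Card `theta-envelope-antitone`: `nonneg_of_envelope_antitone` (B1, pure real analysis, provable now),
  the transfer `EnvelopeAntitoneWindows` and the composition `oddOneSignedWindows_of_envelope`
  (kernel-checked modulo B1 and an a.e.-glue lemma B2).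
-/

noncomputable section

set_option linter.dupNamespace false

namespace Summit.RiemannHypothesis.RiemannHypothesis.Cruxes.OddOneSignedWindows.Ideator1

open Literature.NumberTheory.LFunctions MeasureTheory Set Filter Topology
open Summit.RiemannHypothesis.RiemannHypothesis.Theses.OddSector
open Summit.RiemannHypothesis.RiemannHypothesis.Theorems.OddSector (oddOneSignedWindows_iff)

/-! ## Card A — resonance transport + Diophantine selection -/

/-- `a` keeps distance `≥ w a` from every "reachable resonance" `(1/k) log (n/m)` with
`n, m ≤ e^{3a}`, `1 ≤ k ≤ K` (words of length `≤ K` in the prime-atom transport maps land at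
`a`-translates of such points; `k` = net multiplicity of the edge letter). -/
def IsNonresonantWindow (w : ℝ → ℝ) (K : ℕ) (a : ℝ) : Prop :=
  ∀ n m k : ℕ, 1 ≤ n → 1 ≤ m → 1 ≤ k → k ≤ K →
    (n : ℝ) ≤ Real.exp (3 * a) → (m : ℝ) ≤ Real.exp (3 * a) →
      w a ≤ |a - Real.log ((n : ℝ) / m) / k|

/-- (A1) **Diophantine selection** (union bound over `≤ K e^{6a+6}` resonance centres, each
excluded with radius `w`): if `w` is antitone and eventually `w a · e^{6a+12} · K ≤ 1/8`, every
half-line `[A, ∞)` — indeed every `[a₁, a₁+1]`, `a₁ ≥ A₀` — contains a non-resonant window.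
RH-free, provable now (S/M). -/
def DiophantineSelection : Prop :=
  ∀ (w : ℝ → ℝ) (K : ℕ), Antitone w →
    (∀ᶠ a in atTop, w a * Real.exp (6 * a + 12) * K ≤ 1 / 8) →
      ∀ᶠ a₁ in atTop, ∃ a : ℝ, a ∈ Icc a₁ (a₁ + 1) ∧ IsNonresonantWindow w K a

/-- (A2) **Origin regularity at non-resonant windows** (RH-free; interior regularity of the
windowed Weil operator at the interior point `0`, where no transported edge singularity lands):
a real odd ground state is differentiable at `0` (so `u(t) = u'(0) t + o(t)`), whenever `a` is not
of the form `(1/k) log(n/m)`. Hard (L–XL): log-order interior regularity + transport of the edge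
profile `c₊ |log d|^{-1/2}` along `t ↦ log q − t`, `t ↦ t ± log m`. -/
def OriginDifferentiable : Prop :=
  ∀ a : ℝ, 0 < a → (∀ n m k : ℕ, 1 ≤ n → 1 ≤ m → 1 ≤ k → Real.log ((n : ℝ) / m) ≠ k * a) →
    ∀ u : ℝ → ℂ, IsWeilOddGroundState a u → (∀ᵐ t : ℝ, t ∈ Ioo 0 a → (u t).im = 0) →
      ∃ v : ℝ → ℝ, (∀ᵐ t : ℝ, t ∈ Ioo (-a) a → (u t).re = v t) ∧ ∃ s : ℝ, HasDerivAt v s 0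

/-- **The robust RH-strength core of Card A**: beyond every height there is a whole INTERVAL of
windows on which every NON-RESONANT window carries a real odd ground state that is `≥ 0` a.e. —
i.e. the crux holds on intervals minus the (measure-small, possibly dense) resonant set. -/
def NonresonantIntervalPositivity (w : ℝ → ℝ) (K : ℕ) : Prop :=
  ∀ A : ℝ, ∃ a₁ : ℝ, A ≤ a₁ ∧ ∀ a ∈ Icc a₁ (a₁ + 1), IsNonresonantWindow w K a →
    ∃ u : ℝ → ℂ, IsWeilOddGroundState a u ∧ ∀ᵐ t : ℝ, t ∈ Ioo 0 a → (u t).im = 0 ∧ 0 ≤ (u t).re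

/-- Composition (kernel-checked): the crux from the robust core plus Diophantine selection. -/
theorem oddOneSignedWindows_of_intervals (w : ℝ → ℝ) (K : ℕ) (hw : Antitone w)
    (hsmall : ∀ᶠ a in atTop, w a * Real.exp (6 * a + 12) * K ≤ 1 / 8)
    (hsel : DiophantineSelection) (hcore : NonresonantIntervalPositivity w K) :
    OddOneSignedWindows := by
  rw [oddOneSignedWindows_iff]
  intro A
  obtain ⟨A₀, hA₀⟩ := Filter.eventually_atTop.1 (hsel w K hw hsmall)
  obtain ⟨a₁, hAa₁, hint⟩ := hcore (max A A₀)
  obtain ⟨a, ha, hnr⟩ := hA₀ a₁ (le_trans (le_max_right _ _) hAa₁)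
  obtain ⟨u, hu, hsign⟩ := hint a ha hnr
  exact ⟨a, le_trans (le_trans (le_max_left _ _) hAa₁) ha.1, u, hu, hsign⟩

/-! ## Card B — theta envelope `r = u / (−Φ′)` antitone on the decay zone -/

/-- (B1) Pure real analysis (provable now, S): if `v / T` is antitone on `[t₁, a)` for a positive
`T`, and `v(t) → 0` as `t → a⁻` while `T(a) > 0` (continuity of `T`), then `v ≥ 0` on `[t₁, a)`. -/
theorem nonneg_of_envelope_antitone {a t₁ : ℝ} {v T : ℝ → ℝ} (ht₁a : t₁ < a)
    (hT : ∀ t ∈ Icc t₁ a, 0 < T t) (hTc : ContinuousOn T (Icc t₁ a))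
    (hanti : AntitoneOn (fun t => v t / T t) (Ico t₁ a))
    (hedge : Tendsto v (𝓝[<] a) (𝓝 0)) : ∀ t ∈ Ico t₁ a, 0 ≤ v t := by
  intro t ht
  have hT' : Tendsto T (𝓝[<] a) (𝓝 (T a)) := by
    rw [← nhdsWithin_Ioo_eq_nhdsLT ht₁a]
    exact (hTc.continuousWithinAt ⟨ht₁a.le, le_rfl⟩).mono_left
      (nhdsWithin_mono _ Ioo_subset_Icc_self)
  have hTa : T a ≠ 0 := (hT a ⟨ht₁a.le, le_rfl⟩).ne'
  have hlim : Tendsto (fun s => v s / T s) (𝓝[<] a) (𝓝 0) := by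
    have h := hedge.div hT' hTa
    rw [zero_div] at h
    exact h
  have hev : ∀ᶠ s in 𝓝[<] a, v s / T s ≤ v t / T t := by
    filter_upwards [Ioo_mem_nhdsLT ht.2] with s hs
    exact hanti ⟨ht.1, ht.2⟩ ⟨le_trans ht.1 hs.1.le, hs.2⟩ hs.1.le
  have h0 : 0 ≤ v t / T t := le_of_tendsto hlim hev
  have hTt : 0 < T t := hT t ⟨ht.1, ht.2.le⟩
  have : v t = v t / T t * T t := by field_simp
  rw [this]
  exact mul_nonneg h0 hTt.le

/-- **Transfer C⁺ of Card B** (`EnvelopeAntitoneWindows`): on unboundedly many windows some odd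
ground state `u` is real a.e. on `(0,a)`, has a linear lower bound `κ t` near the origin, tends to
`0` at the edge, and its THETA ENVELOPE `u / (−Φ′)` (`weilThetaPhiDeriv = Φ′ < 0` on `(0,∞)`,
`weilThetaPhiDeriv_neg_of_pos`) is antitone on the decay zone `[t₁, a)`. -/
def EnvelopeAntitoneWindows : Prop :=
  ∀ A : ℝ, ∃ a : ℝ, A ≤ a ∧ ∃ u : ℝ → ℂ, IsWeilOddGroundState a u ∧
    ∃ (v : ℝ → ℝ) (t₁ κ : ℝ), 0 < κ ∧ 0 < t₁ ∧ t₁ < a ∧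
      (∀ᵐ t : ℝ, t ∈ Ioo 0 a → u t = (v t : ℂ)) ∧
      (∀ t ∈ Ioc 0 t₁, κ * t ≤ v t) ∧
      AntitoneOn (fun t => v t / (-weilThetaPhiDeriv t)) (Ico t₁ a) ∧
      Tendsto v (𝓝[<] a) (𝓝 0)

/-- (B2) a.e.-glue (provable now, S): a pointwise-nonnegative real representative gives the crux's
a.e. sign clause. -/
theorem ae_sign_of_representative {a : ℝ} {u : ℝ → ℂ} {v : ℝ → ℝ}
    (huv : ∀ᵐ t : ℝ, t ∈ Ioo 0 a → u t = (v t : ℂ)) (hv : ∀ t ∈ Ioo 0 a, 0 ≤ v t) :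
    ∀ᵐ t : ℝ, t ∈ Ioo 0 a → (u t).im = 0 ∧ 0 ≤ (u t).re := by
  filter_upwards [huv] with t ht htI
  rw [ht htI]
  exact ⟨Complex.ofReal_im _, by simpa using hv t htI⟩

/-- Composition (kernel-checked modulo B1): the crux from the envelope transfer. -/
theorem oddOneSignedWindows_of_envelope (h : EnvelopeAntitoneWindows) : OddOneSignedWindows := by
  rw [oddOneSignedWindows_iff]
  intro A
  obtain ⟨a, hAa, u, hu, v, t₁, κ, hκ, ht₁, ht₁a, huv, horig, hanti, hedge⟩ := h A
  refine ⟨a, hAa, u, hu, ae_sign_of_representative huv ?_⟩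
  have hT : ∀ t ∈ Icc t₁ a, 0 < -weilThetaPhiDeriv t := fun t ht =>
    neg_pos.2 (weilThetaPhiDeriv_neg_of_pos (lt_of_lt_of_le ht₁ ht.1))
  have hTc : ContinuousOn (fun t => -weilThetaPhiDeriv t) (Icc t₁ a) :=
    (continuous_weilThetaPhiDeriv.neg).continuousOn
  have hdecay := nonneg_of_envelope_antitone ht₁a hT hTc hanti hedge
  intro t ht
  rcases le_or_gt t t₁ with h₁ | h₁
  · exact le_trans (mul_nonneg hκ.le ht.1.le) (horig t ⟨ht.1, h₁⟩)
  · exact hdecay t ⟨h₁.le, ht.2⟩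

end Summit.RiemannHypothesis.RiemannHypothesis.Cruxes.OddOneSignedWindows.Ideator1

end
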